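import Summits.BirchSwinnertonDyer.Rank1Residual.Additive.RamifiedSevenGenusThetaNorm
import HarnessLib

/-!
# `𝒞₇` genus road, crux K1ᵘ: the unit-side identity UP TO A UNIT OF `Λ` (repair R1ᵘ after the (S5) verdict), the genus
# residue from it, and the K1ᵘ input ledger in that letter

Cell bsd-cm, seat bsd-cm-k-ty1 g25 (SUMMON `wake/SUMMON-bsd-cm-k-ty1-20260830T1731Z.md` 16c4e918e43e0aee, row GENUS-PORT-A3),
answering the critic's (S5) VERDICT (idea-crit-15 g14, bsd-cm INBOX 2026-08-30T18:37:21Z, probe `pub/ideators/idea-crit-15/S5_orbit_g14.lean`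
57a0fc5c83d5df02): the value pin `IsNormedEllipticUnitFamily F θu` hides the identification `e : K̄ → ℚ̄` under `∃` and never aligns it
with the frame's root system `F.ζsys`, so the Galois torsor `Gal(F′_∞/ℚ)` moves `θu` (hence `e_{η₁}θ^𝔞`, by a UNIT `η₁(δ)·(1+T)^a` of
`Λ`) while `e_{η₁}ξ`, `x`, `Θm` stay put; the EXACT-constant letter `UnitSideIdentityShape` («`∃ u ∈ {±1,±2}`, `θ = (c₀·u·x·Θm)•ξ`»)
is therefore false modulo `Nonempty` + non-degeneracy (critic's `not_forall_unitSide`).  What print delivers WITHOUT an alignment pin is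
the identity UP TO `Λˣ`; what the road consumes downstream is the GENUS RESIDUE, a `Λˣ`-invariant (`7 ∣ w·G ⟺ 7 ∣ G`).  This file types
that letter; the companion `RamifiedSevenGenusUnitSideOrbit.lean` certifies that the unit letter moves along the orbit.  ADDITIVE: no
existing definition is edited; `UnitSideIdentityShape` / `OrientedGenusFactorisationShape` stay as the exact-constant refinements (they
IMPLY the new shapes: `unitFactorisationShape_of_orientedGenusFactorisationShape`, `unitSideIdentityShapeUpToUnit_of_unitSideIdentityShape`).

## Contents (all theorems proved; NO named fact; kit 0)

* §1 `OrientedGenusDatum.UnitFactorisationShape d :≡ ∃ w : Λˣ, θ = (w·G_𝔞)•ξ` (`G_𝔞 = genusFactorM = C c₀·C u_b·x·Θm`; since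
  `c₀ = −½`, `u_b ∈ {±1,±2}` are `7`-adic units this is «`∃ w : Λˣ, θ = (w·x·Θm)•ξ`», `unitFactorisationShape_iff_exists_unit`);
  `UnitSideIdentityShapeUpToUnit F θu :≡ ∀ d : OrientedGenusDatum F θu, d.UnitFactorisationShape` — the candidate (5) conjunct.
* §2 the genus residue from the unit letter: `genusResidueNonzero_of_unitFactorisation` (Tsuji Thm 3.1 (i) + Ferrero–Washington ×2, as
  in row A's `genusResidueNonzero_of_orientedFactorisation` with the unit threaded), and `exists_genusResidueNonzero_of_unitK1u` whose
  conclusion is the `hRes` binder of block (B3)'s `residualNonvanishingSeven_of_genus` VERBATIM.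
* §3 the K1ᵘ input ledger in the unit letter: ★ `genusUnitFactorisationSeven_of_inputs (h : <ledger>)` (its binder type is the
  candidate v14 stub letter), ★★ `genusUnitSideInputsSevenUpToUnit_of_identity` (the ledger ⟸ Tsuji L6.2 (a), de Shalit II.2.5 (i)/
  II.2.4 (i) named facts + the identity up to unit), `…_of_v13` (the REGISTERED v13 letter implies the unit letter: v14 asks for AT MOST
  v13), `exists_genusResidueNonzero_of_identityUpToUnit` (the `hRes` letter from the facts + the identity up to unit).

HONEST LABEL: conditional theorems and definitions only; K1ᵘ is NOT proved; no item closes; stmt-BirchSwinnertonDyer-19945 is OPEN;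
`X12.CMRamifiedSeven` is NOT proved; BSD is claimed for no curve.

## References
K. Kato, Astérisque 295 (2004) §15.5 (15.5.1), §15.6 (pp. 253–254) [Kato2004Asterisque]; T. Tsuji, J. Number Theory 78 (1999) §3 Thm 3.1,
§6 Lemma 6.2 (a) (pp. 5–6, 20–21) [Tsuji1999]; S. Lang, *Cyclotomic Fields I–II* (1990) Ch. 10 §2 Thm 2.3 (PDF p. 172) [Lang1990];
B. Ferrero, L. Washington, Ann. of Math. 109 (1979) [FerreroWashington1979]; E. de Shalit (1987) II.2.4–II.2.5 [deShalit1987];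
critic probe `S5_orbit_g14.lean` (idea-crit-15 g14, 57a0fc5c83d5df02).
-/

noncomputable section

open scoped NumberField
open PowerSeries IsDedekindDomain Field
open Literature.NumberTheory.EllipticCurves
open Literature.NumberTheory.EllipticCurves.IwasawaAlgebra
open Literature.NumberTheory.IwasawaTheory
open Literature.NumberTheory.IwasawaTheory.StickelbergerSeries
open Literature.NumberTheory.ComplexMultiplication.EllipticUnits
open Literature.NumberTheory.NumberFields

namespace Summit.BirchSwinnertonDyer.Rank1Residual.Additive.GenusSeven

/-! ## §1 The identity up to a unit of `Λ` -/

namespace OrientedGenusDatum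

variable {F : GenusFrame} {θu : ∀ n : ℕ, globalUnitsOf (F.layer n)} (d : OrientedGenusDatum F θu)

/-- **`d.UnitFactorisationShape` — K1ᵘ's identity UP TO A UNIT on an oriented datum**: `e_{η₁}θ^𝔞 = (w·G_𝔞)•e_{η₁}ξ` in
`𝓤^{η₁}` for some `w ∈ Λˣ`, `G_𝔞 = −½·u_b·x·Θm` (`genusFactorM`).  What (15.5.1) + Lang Ch. 10 §2 deliver on the `η₁`-line
without a root-of-unity alignment between the elliptic and the cyclotomic side (the residual `w` is a coordinate on the torsor
`η₁(Δ)·(1+T)^{ℤ₇}`).  A predicate; nothing asserted.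
[cite: Kato2004Asterisque, §15.5 (15.5.1) and §15.6 (pp. 253–254)] [cite: Lang1990, Ch. 10 §2 (2)–(3) (PDF p. 171)] -/
def UnitFactorisationShape : Prop :=
  ∃ w : (IwasawaAlgebra 7)ˣ, d.θ = ((w : IwasawaAlgebra 7) * d.genusFactorM) • d.ξ

/-- Unfolding. [cite: Kato2004Asterisque, §15.5–15.6 (pp. 253–254)] -/
theorem unitFactorisationShape_iff :
    d.UnitFactorisationShape ↔ ∃ w : (IwasawaAlgebra 7)ˣ, d.θ = ((w : IwasawaAlgebra 7) * d.genusFactorM) • d.ξ :=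
  Iff.rfl

/-- The exact-constant shape implies the unit shape (`w = 1`). [cite: Kato2004Asterisque, §15.5 (15.5.1) (p. 253)] -/
theorem unitFactorisationShape_of_orientedGenusFactorisationShape (h : OrientedGenusFactorisationShape d) :
    d.UnitFactorisationShape :=
  ⟨1, by rw [Units.val_one, one_mul]; exact h⟩

/-- `C c₀ · C u_b` is a unit of `Λ` (`c₀ = −½`, `u_b ∈ {±1, ±2}` are `7`-adic units). [cite: Lang1990, Ch. 10 §1 (PDF p. 167)] -/
theorem isUnit_C_cZero_mul_C_ub :
    IsUnit (C GenusDatum.cZero * C ((d.ub : ℤ) : ℤ_[7]) : IwasawaAlgebra 7) :=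
  (GenusDatum.isUnit_cZero.map C).mul (d.isUnit_ub.map C)

/-- **The constant-free phrasing**: `d.UnitFactorisationShape ⟺ ∃ w ∈ Λˣ, θ = (w·x·Θm)•ξ` (the visible constants `c₀`,
`u_b` are absorbed in the unit). [cite: Kato2004Asterisque, §15.5–15.6 (pp. 253–254)] -/
theorem unitFactorisationShape_iff_exists_unit :
    d.UnitFactorisationShape ↔
      ∃ w : (IwasawaAlgebra 7)ˣ, d.θ = ((w : IwasawaAlgebra 7) * d.x * d.Θm) • d.ξ := by
  obtain ⟨c, hc⟩ := d.isUnit_C_cZero_mul_C_ub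
  constructor
  · rintro ⟨w, hw⟩
    refine ⟨w * c, ?_⟩
    rw [hw, genusFactorM_def, Units.val_mul, hc]
    congr 1
    ring
  · rintro ⟨w, hw⟩
    refine ⟨w * c⁻¹, ?_⟩
    rw [hw, genusFactorM_def, Units.val_mul, ← hc]
    congr 1
    rw [show (w : IwasawaAlgebra 7) * ↑c⁻¹ * ((c : IwasawaAlgebra 7) * d.x * d.Θm) =
        (w : IwasawaAlgebra 7) * (↑c⁻¹ * ↑c) * d.x * d.Θm by ring, Units.inv_mul, mul_one]

end OrientedGenusDatum

/-- `±1, ±2` are `7`-adic units. [cite: Lang1990, Ch. 10 §1 (PDF p. 167)] -/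
theorem isUnit_intCast_of_mem_branchUnits {u : ℤ} (hu : u = 1 ∨ u = -1 ∨ u = 2 ∨ u = -2) :
    IsUnit ((u : ℤ) : ℤ_[7]) := by
  rw [PadicInt.isUnit_iff]
  have h1 : ‖((u : ℤ) : ℤ_[7])‖ ≤ 1 := PadicInt.norm_le_one _
  have h : ¬ ‖((u : ℤ) : ℤ_[7])‖ < 1 := by
    rw [PadicInt.norm_int_lt_one_iff_dvd]
    rcases hu with h | h | h | h <;> rw [h] <;> omega
  exact le_antisymm h1 (not_lt.mp h)

/-- **`UnitSideIdentityShapeUpToUnit F θu` — K1ᵘ's identity UP TO `Λˣ` as a property of `(F, θu)`** (the candidate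
conjunct (5) of the K1ᵘ input ledger after the (S5) verdict): every oriented genus datum over `(F, θu)` satisfies
`e_{η₁}θ^𝔞 = (w·G_𝔞)•e_{η₁}ξ` for some `w ∈ Λˣ`.  Invariant under the Galois torsor of the value pin (§4).  A predicate;
nothing asserted. [cite: Kato2004Asterisque, §15.5 (15.5.1) and §15.6 (pp. 253–254)] [cite: Lang1990, Ch. 10 §2 (2)–(3) (PDF p. 171)] -/
def UnitSideIdentityShapeUpToUnit (F : GenusFrame) (θu : ∀ n : ℕ, globalUnitsOf (F.layer n)) : Prop :=
  ∀ d : OrientedGenusDatum F θu, d.UnitFactorisationShape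

section Shapes

variable {F : GenusFrame} {θu : ∀ n : ℕ, globalUnitsOf (F.layer n)}

/-- The exact-constant identity implies the identity up to unit (`w = C u · (C u_b)⁻¹`).
[cite: Kato2004Asterisque, §15.5 (15.5.1) (p. 253)] -/
theorem unitSideIdentityShapeUpToUnit_of_unitSideIdentityShape (h : UnitSideIdentityShape F θu) :
    UnitSideIdentityShapeUpToUnit F θu := by
  intro d
  obtain ⟨u, hu, hθ⟩ := h d
  rw [d.unitFactorisationShape_iff_exists_unit]
  obtain ⟨c, hc⟩ := (GenusDatum.isUnit_cZero.map C).mul ((isUnit_intCast_of_mem_branchUnits hu).map C)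
  exact ⟨c, by rw [hθ, hc]⟩

/-- The residual (inhabited data + exact identity) implies the identity up to unit. [cite: Kato2004Asterisque, §15.5–15.6 (pp. 253–254)] -/
theorem unitSideIdentityShapeUpToUnit_of_residual (h : GenusUnitSideResidual F θu) :
    UnitSideIdentityShapeUpToUnit F θu :=
  unitSideIdentityShapeUpToUnit_of_unitSideIdentityShape h.2

end Shapes

/-! ## §2 The genus residue (G6) from the identity up to unit -/

section Residue

variable {F : GenusFrame} {θu : ∀ n : ℕ, globalUnitsOf (F.layer n)} (d : OrientedGenusDatum F θu)

/-- `7 ∤ w·G_𝔞` for `w ∈ Λˣ` (LEMMA M + Ferrero–Washington, as for `G_𝔞`). [cite: Lang1990, Ch. 10 §2 Thm. 2.3 (PDF p. 172)] -/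
theorem OrientedGenusDatum.not_C_seven_dvd_unit_mul_genusFactorM (h₂' : ferreroWashington_stickelbergerSeries_unitCoeff)
    (w : (IwasawaAlgebra 7)ˣ) : ¬ (C (7 : ℤ_[7]) : IwasawaAlgebra 7) ∣ (w : IwasawaAlgebra 7) * d.genusFactorM := by
  intro h
  rcases prime_C_seven.dvd_or_dvd h with h | h
  · exact prime_C_seven.not_unit (isUnit_of_dvd_unit h w.isUnit)
  · exact d.not_C_seven_dvd_genusFactorM h₂' h

/-- Coleman detects `7`-divisibility for the identity up to unit: `e_{η₁}θ^𝔞 = 7·y` forces `7 ∣ (w·G_𝔞)·g_{η₁}`.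
[cite: Tsuji1999, Thm. 3.1 (i) (p. 6)] -/
theorem OrientedGenusDatum.C_seven_dvd_unit_mul_genusFactorM_mul_g (h₄ : tsuji1999_thm31_colemanMap)
    {w : (IwasawaAlgebra 7)ˣ} (hK1 : d.θ = ((w : IwasawaAlgebra 7) * d.genusFactorM) • d.ξ) {y : F.U.chiPart F.η₁}
    (hy : d.θ = (C (7 : ℤ_[7]) : IwasawaAlgebra 7) • y) :
    (C (7 : ℤ_[7]) : IwasawaAlgebra 7) ∣ (w : IwasawaAlgebra 7) * d.genusFactorM * F.g := by
  obtain ⟨Col, hCol⟩ := F.exists_colemanMap h₄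
  rw [d.cycChi_eq_span, Submodule.map_span, Set.image_singleton] at hCol
  obtain ⟨w', hw'⟩ := Ideal.span_singleton_eq_span_singleton.mp hCol
  have h1 : Col d.θ = (w : IwasawaAlgebra 7) * d.genusFactorM * Col d.ξ := by rw [hK1, map_smul, smul_eq_mul]
  have h2 : Col d.θ = C (7 : ℤ_[7]) * Col y := by rw [hy, map_smul, smul_eq_mul]
  refine ⟨Col y * w', ?_⟩
  calc (w : IwasawaAlgebra 7) * d.genusFactorM * F.g
        = (w : IwasawaAlgebra 7) * d.genusFactorM * (Col.toLinearMap d.ξ * w') := by rw [hw']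
    _ = Col d.θ * w' := by rw [LinearEquiv.coe_coe, h1]; ring
    _ = C (7 : ℤ_[7]) * (Col y * w') := by rw [h2, mul_assoc]

/-- **(G6) FROM THE IDENTITY UP TO UNIT**: `e_{η₁}θ^𝔞 ∉ 7·𝓤^{η₁}` — GIVEN Tsuji 1999 Thm 3.1 (i) and Ferrero–Washington in
its two printed readings.  The unit is harmless: `7 ∣ w·G ⟺ 7 ∣ G`.  Conditional theorem; nothing about BSD is claimed.
[cite: Tsuji1999, Thm. 3.1 (i) (p. 6)] [cite: Lang1990, Ch. 10 §2 Thm. 2.3 (PDF p. 172)] [cite: FerreroWashington1979, Theorem (p. 377)] -/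
theorem genusResidueNonzero_of_unitFactorisation (h₄ : tsuji1999_thm31_colemanMap)
    (h₂ : ferreroWashington_kubotaLeopoldtSeries_unitCoeff) (h₂' : ferreroWashington_stickelbergerSeries_unitCoeff)
    (hK1 : d.UnitFactorisationShape) : GenusResidueNonzeroShape d.toGenusDatum := by
  obtain ⟨w, hw⟩ := hK1
  rw [genusResidueNonzeroShape_iff_not_exists]
  rintro ⟨y, hy⟩
  rcases prime_C_seven.dvd_or_dvd (d.C_seven_dvd_unit_mul_genusFactorM_mul_g h₄ hw hy) with h | h
  · exact d.not_C_seven_dvd_unit_mul_genusFactorM h₂' w h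
  · exact F.not_C_seven_dvd_g h₂ h

end Residue

/-- **The `hRes` input of block (B3) (`residualNonvanishingSeven_of_genus`, binder type VERBATIM) from a K1ᵘ letter in the
unit form** and the three printed facts of (G6). [cite: Tsuji1999, Thm. 3.1 (i) (p. 6)] [cite: Lang1990, Ch. 10 §2 Thm. 2.3 (PDF p. 172)] -/
theorem exists_genusResidueNonzero_of_unitK1u (h₄ : tsuji1999_thm31_colemanMap)
    (h₂ : ferreroWashington_kubotaLeopoldtSeries_unitCoeff) (h₂' : ferreroWashington_stickelbergerSeries_unitCoeff)
    (hK1u : ∀ (F : GenusFrame) (θu : ∀ n : ℕ, globalUnitsOf (F.layer n)), IsNormedEllipticUnitFamily F θu →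
      ∃ d : OrientedGenusDatum F θu, d.UnitFactorisationShape) :
    ∀ (F : GenusFrame) (θu : ∀ n : ℕ, globalUnitsOf (F.layer n)), IsNormedEllipticUnitFamily F θu →
      ∃ d : GenusDatum F θu, GenusResidueNonzeroShape d := by
  intro F θu hpin
  obtain ⟨d, hd⟩ := hK1u F θu hpin
  exact ⟨d.toGenusDatum, genusResidueNonzero_of_unitFactorisation d h₄ h₂ h₂' hd⟩

/-! ## §3 The K1ᵘ input ledger in the unit letter -/

section Inputs

variable {F : GenusFrame} {θu : ∀ n : ℕ, globalUnitsOf (F.layer n)}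

/-- Inputs (2)–(4) inhabit the oriented data (row A2's assembly); the identity up to unit then gives a datum with the unit
factorisation. [cite: Tsuji1999, §3 (pp. 5–6), §6 (pp. 20–21)] [cite: Kato2004Asterisque, §15.5–15.6 (pp. 253–254)] -/
theorem exists_unitFactorisation_of_inputs (hθP : F.IsPrincipalPowFamily θu) (hθN : F.IsNormCoherentPowFamily θu)
    {ξu : ∀ n : ℕ, globalUnitsOf (F.layer n)} (hξ : SinnottFamilyShape F ξu) (hspan : SinnottSpanShape F ξu)
    (hid : UnitSideIdentityShapeUpToUnit F θu) :
    ∃ d : OrientedGenusDatum F θu, d.UnitFactorisationShape := by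
  obtain ⟨d⟩ := nonempty_orientedGenusDatum_of_inputs hθP hθN hξ hspan
  exact ⟨d, hid d⟩

end Inputs

/-- ★ **THE K1ᵘ INPUT LEDGER IN THE UNIT LETTER ⟹ the unit-form K1ᵘ letter** «every value-pinned `(F, θu)` carries an oriented
datum with `e_{η₁}θ^𝔞 = (w·G_𝔞)•e_{η₁}ξ`, `w ∈ Λˣ`».  The binder type of `h` is the v13 stub letter with conjunct (5) replaced by
`UnitSideIdentityShapeUpToUnit F θu` — the CANDIDATE v14 letter.  Conditional theorem; `h` is NOT proved here.
[cite: Kato2004Asterisque, §15.5 (15.5.1), §15.6 (pp. 253–254)] [cite: Tsuji1999, §3 (pp. 5–6), §6 Lemma 6.1–6.2 (pp. 20–21)] -/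
theorem genusUnitFactorisationSeven_of_inputs
    (h : ∀ (F : GenusFrame) (θu : ∀ n : ℕ, globalUnitsOf (F.layer n)), IsNormedEllipticUnitFamily F θu →
      (F.IsPrincipalPowFamily θu ∧ F.IsNormCoherentPowFamily θu) ∧
        (∀ ξu : ∀ n : ℕ, globalUnitsOf (F.layer n),
          (∀ n : ℕ, (((ξu n : globalUnitsOf (F.layer n)) : (AlgebraicClosure ℚ)ˣ) : AlgebraicClosure ℚ) =
              CyclotomicUnits.sinnottNorm (t := 7 ^ (n + 1) * F.d) (F.layer n) (F.ζsys n) 1) →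
            (F.IsPrincipalPowFamily ξu ∧ F.IsNormCoherentPowFamily ξu) ∧ SinnottSpanShape F ξu) ∧
        UnitSideIdentityShapeUpToUnit F θu) :
    ∀ (F : GenusSeven.GenusFrame) (θu : ∀ n : ℕ, globalUnitsOf (F.layer n)),
      GenusSeven.IsNormedEllipticUnitFamily F θu →
        ∃ d : GenusSeven.OrientedGenusDatum F θu, d.UnitFactorisationShape := by
  intro F θu hθu
  obtain ⟨⟨hθP, hθN⟩, hξ, hid⟩ := h F θu hθu
  obtain ⟨ξu, hval⟩ := F.exists_sinnottUnits
  obtain ⟨⟨hξP, hξN⟩, hspan⟩ := hξ ξu hval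
  exact exists_unitFactorisation_of_inputs hθP hθN ⟨hval, hξP, hξN⟩ hspan hid

/-- **MONOTONICITY: the REGISTERED v13 letter (`stub_genusUnitSideInputsSeven`, conjunct (5) = the exact-constant
`UnitSideIdentityShape`) implies the unit letter** — a v14 re-cut asks for AT MOST what v13 asks.
[cite: Kato2004Asterisque, §15.5 (15.5.1) (p. 253)] -/
theorem genusUnitSideInputsSevenUpToUnit_of_v13
    (h : ∀ (F : GenusFrame) (θu : ∀ n : ℕ, globalUnitsOf (F.layer n)), IsNormedEllipticUnitFamily F θu →
      (F.IsPrincipalPowFamily θu ∧ F.IsNormCoherentPowFamily θu) ∧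
        (∀ ξu : ∀ n : ℕ, globalUnitsOf (F.layer n),
          (∀ n : ℕ, (((ξu n : globalUnitsOf (F.layer n)) : (AlgebraicClosure ℚ)ˣ) : AlgebraicClosure ℚ) =
              CyclotomicUnits.sinnottNorm (t := 7 ^ (n + 1) * F.d) (F.layer n) (F.ζsys n) 1) →
            (F.IsPrincipalPowFamily ξu ∧ F.IsNormCoherentPowFamily ξu) ∧ SinnottSpanShape F ξu) ∧
        UnitSideIdentityShape F θu) :
    ∀ (F : GenusFrame) (θu : ∀ n : ℕ, globalUnitsOf (F.layer n)), IsNormedEllipticUnitFamily F θu →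
      (F.IsPrincipalPowFamily θu ∧ F.IsNormCoherentPowFamily θu) ∧
        (∀ ξu : ∀ n : ℕ, globalUnitsOf (F.layer n),
          (∀ n : ℕ, (((ξu n : globalUnitsOf (F.layer n)) : (AlgebraicClosure ℚ)ˣ) : AlgebraicClosure ℚ) =
              CyclotomicUnits.sinnottNorm (t := 7 ^ (n + 1) * F.d) (F.layer n) (F.ζsys n) 1) →
            (F.IsPrincipalPowFamily ξu ∧ F.IsNormCoherentPowFamily ξu) ∧ SinnottSpanShape F ξu) ∧
        UnitSideIdentityShapeUpToUnit F θu :=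
  fun F θu hθu => ⟨(h F θu hθu).1, (h F θu hθu).2.1, unitSideIdentityShapeUpToUnit_of_unitSideIdentityShape (h F θu hθu).2.2⟩

/-- ★★ **THE K1ᵘ INPUT LEDGER IN THE UNIT LETTER, REDUCED TO THE IDENTITY UP TO UNIT** modulo three PUBLISHED named facts:
(4b) ⟸ Tsuji 1999 Lemma 6.2 (a) (`sinnottSpanShape_of_pin`, p782386), (2b″) ⟸ de Shalit II.2.5 (i)/II.2.4 (i)
(`isGlobalNormCoherent_pow_twelve_of_pin`, p782533), (2a)/(3a)/(3b′) theorems (p778024, p780861).  Conditional theorem; the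
facts and `h` are NOT proved here. [cite: Tsuji1999, §6 Lemma 6.2 (a) (p. 21)] [cite: deShalit1987, II.2.5 Proposition (i)]
[cite: Kato2004Asterisque, §15.5–15.6 (pp. 253–254)] -/
theorem genusUnitSideInputsSevenUpToUnit_of_identity (hT : tsuji1999_lemma62a_cycChiGenerator)
    (h25 : DeShalit1987.prop25_i_normRelation) (h24i : DeShalit1987.prop24_i_mem_rayClassField)
    (h : ∀ (F : GenusFrame) (θu : ∀ n : ℕ, globalUnitsOf (F.layer n)), IsNormedEllipticUnitFamily F θu →
      UnitSideIdentityShapeUpToUnit F θu) :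
    ∀ (F : GenusFrame) (θu : ∀ n : ℕ, globalUnitsOf (F.layer n)), IsNormedEllipticUnitFamily F θu →
      (F.IsPrincipalPowFamily θu ∧ F.IsNormCoherentPowFamily θu) ∧
        (∀ ξu : ∀ n : ℕ, globalUnitsOf (F.layer n),
          (∀ n : ℕ, (((ξu n : globalUnitsOf (F.layer n)) : (AlgebraicClosure ℚ)ˣ) : AlgebraicClosure ℚ) =
              CyclotomicUnits.sinnottNorm (t := 7 ^ (n + 1) * F.d) (F.layer n) (F.ζsys n) 1) →
            (F.IsPrincipalPowFamily ξu ∧ F.IsNormCoherentPowFamily ξu) ∧ SinnottSpanShape F ξu) ∧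
        UnitSideIdentityShapeUpToUnit F θu := by
  intro F θu hθu
  have hN := F.isGlobalNormCoherent_pow_twelve_of_pin h25 h24i hθu
  exact ⟨⟨F.isPrincipalPowFamily θu, F.isNormCoherentPowFamily_of_isGlobalNormCoherent_pow (m := 12) (k := 4) rfl hN⟩,
    fun ξu hval => ⟨⟨F.isPrincipalPowFamily ξu,
      F.isNormCoherentPowFamily_of_isGlobalNormCoherent (F.isGlobalNormCoherent_of_sinnott_pin hval)⟩,
      F.sinnottSpanShape_of_pin hT hval⟩, h F θu hθu⟩

/-- **The `hRes` letter of block (B3) from the facts and the identity up to unit** (what a v14 composition feeds to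
`residualNonvanishingSeven_of_genus` / `…_of_k2cPinned`). [cite: Tsuji1999, Thm. 3.1 (i) (p. 6), §6 Lemma 6.2 (a) (p. 21)]
[cite: Lang1990, Ch. 10 §2 Thm. 2.3 (PDF p. 172)] -/
theorem exists_genusResidueNonzero_of_identityUpToUnit (h₄ : tsuji1999_thm31_colemanMap)
    (h₂ : ferreroWashington_kubotaLeopoldtSeries_unitCoeff) (h₂' : ferreroWashington_stickelbergerSeries_unitCoeff)
    (hT : tsuji1999_lemma62a_cycChiGenerator) (h25 : DeShalit1987.prop25_i_normRelation)
    (h24i : DeShalit1987.prop24_i_mem_rayClassField)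
    (h : ∀ (F : GenusFrame) (θu : ∀ n : ℕ, globalUnitsOf (F.layer n)), IsNormedEllipticUnitFamily F θu →
      UnitSideIdentityShapeUpToUnit F θu) :
    ∀ (F : GenusFrame) (θu : ∀ n : ℕ, globalUnitsOf (F.layer n)), IsNormedEllipticUnitFamily F θu →
      ∃ d : GenusDatum F θu, GenusResidueNonzeroShape d :=
  exists_genusResidueNonzero_of_unitK1u h₄ h₂ h₂'
    (genusUnitFactorisationSeven_of_inputs (genusUnitSideInputsSevenUpToUnit_of_identity hT h25 h24i h))

end Summit.BirchSwinnertonDyer.Rank1Residual.Additive.GenusSeven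

end
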